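import Mathlib
import HarnessLib
import Literature.Analysis.FluidPDE.VectorCalculus
import Summits.NavierStokesRegularity.NavierStokesRegularity.Theorems.UnthreadedDoorAntidynamoEvenRungCentre
import Summits.NavierStokesRegularity.NavierStokesRegularity.Theorems.UnthreadedDoorAntidynamoRadialGradientUnthreaded
import Summits.NavierStokesRegularity.NavierStokesRegularity.Theorems.UnthreadedDoorAntidynamoSingleDegreeRungGradientBranch
import Summits.NavierStokesRegularity.NavierStokesRegularity.Theorems.UnthreadedDoorCellFluxZonalVorticityVanishes
import Summits.NavierStokesRegularity.NavierStokesRegularity.Theorems.UnthreadedDoorConstantOfIrrotational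
import Summits.NavierStokesRegularity.NavierStokesRegularity.Theorems.UnthreadedDoorToroidalPotential
import Summits.NavierStokesRegularity.NavierStokesRegularity.Theorems.UnthreadedDoorVorticityOfClass

/-!
# Route `UnthreadedDoor` / `ThreadingFlux`, crux `PoloidalLiouville` (stmt-NavierStokesRegularity-1222), antidynamo v2 skeleton,
# rung `stub_singleDegreeRung`: ★★★ THE RUNG HOLDS FOR EVERY ZONAL PROFILE (any degree), and AT ONE SLICE THE EVEN RUNG IS
# «(E1) data ⟹ constant slice» FOR EVERY PROFILE — the «KNSS transfer for the zonal quadratic» is ALREADY IN THE TREE (cell-flux Z)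

Support file (census instrument decomp-ns-census-1 g32, cell decomp-ns; `--supports stmt-NavierStokesRegularity-1222 --as helper`; 0 kit).
CENSUS CORRECTION by cross-skeleton indexing.  Hands g0/g1 and the census (v28–v32) listed, as a remaining step of the EVEN-degree rung after the
(E1) assembly, a «KNSS transfer for the zonal quadratic (l = 2, axisymmetric without swirl; KNSS 2009 Thm 5.2)».  That transfer is a TREE THEOREM on
the CELL-FLUX skeleton of the same crux: `CellFlux.zonalUnthreadedVorticityVanishes` (`…CellFluxZonalVorticityVanishes`, composition of
`zonalKinematic` / `axisFrozen` / `forwardVanishing` / `knssTransfer` over the PROVED `Literature.Analysis.FluidPDE.knss_axisymmetric_no_swirl_holds`)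
— an unthreaded (`curl (v t) x = ∇(T t)(x) × (x − x₀)` for SOME `T`, no regularity asked) bounded ancient mild solution, smooth on the slab, whose
vorticity is at every time orthogonal to a non-zero constant direction, is IRROTATIONAL.  For the single-degree rung with a ZONAL profile `P`
(`∃ a ≠ 0, ∀ y, det3 a y (∇P y) = 0` — coaxial gradient; ANY degree `l ≥ 2`, not only the quadratic) both hypotheses of Z are tree output:

* the LINK: the rung's slices are unthreaded (junk-robust tangency `inner_curl_eq_zero_of_eq_gradient_add_smul_sub`, as in
  `Antidynamo.singleDegree_unthreaded`), the class has bounded vorticity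
  (`PoloidalLiouville.exists_norm_curl_le`, p629171), so `PoloidalLiouville.toroidalPotential` delivers `T`;
* the DIRECTION: off the centre `curl (v t) x = ĝ(‖y‖) • (∇P(y) × y)` (S2, `singleDegree_vorticity_structure`, p797227), and
  `⟪a, ∇P(y) × y⟫ = det3 a (∇P y) y = −det3 a y (∇P y) = 0`; at the centre the link itself gives `curl (v t) x₀ = ∇T × 0 = 0`.

Hence (`constantOfIrrotational`):

* ★★★ `singleDegreeRung_zonal` — the registered rung `StubSingleDegreeRung` with the ONE extra conjunct «`P` zonal» (as `singleDegreeRung_odd`,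
  p798877, carries «`Odd l`»): constant slices (`P = 0` is the gradient branch).
* ★★ `evenRung_slice_const_of_rung` — UNDER THE RUNG'S VERBATIM HYPOTHESES (`P ≠ 0`), at ONE slice `t < 0`, the (E1) data of
  `evenRung_slice_alternative_of_rung` (p811643: `ĝ, a, k, c, e` with the curl representation, the kinematic normal form, the divergence relation and
  the single-degree vorticity identity) ⟹ THE SLICE IS CONSTANT, for EVERY profile (zonal: by ★★★ at all slices; non-zonal: the alternative's
  zonal disjunct is refuted).
* ★★ `singleDegreeRung_of_sliceData` — the rung's conclusion from the rung's hypotheses plus the (E1) data AT EVERY SLICE.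

MEANING: after this file the even rung's ONLY remaining piece is the (E1) ASSEMBLY PROPER — produce, at each slice, `(a, k, c, e)` and the identity
from the junk representation and the vorticity equation (hand-sized); NO KNSS/symmetry step remains; the WALL `stub_scalarLiouville` is untouched.

HONEST LABEL: composition of tree theorems (two skeletons of one crux) plus one line of determinant algebra, serving the open EVEN-degree rung of an
S-free Liouville engine; the rung in general, the wall, `PoloidalLiouville` (1222) and Navier–Stokes regularity are NOT touched (crux 1222 is
INCOMPARABLE with the summit; descent inside the door's cone, decorative for the summit).  Nothing here proves NavierStokesRegularity.
[cite: KochNadirashviliSereginSverak2009, Thm 5.2 (arXiv:0709.3599 pp. 9–10)]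
-/

noncomputable section

-- the summit and its single sub-problem share the name (CONVENTIONS §1), as in every Theorems file
set_option linter.dupNamespace false

open scoped Topology InnerProductSpace RealInnerProductSpace ContDiff
open Filter Set Metric MeasureTheory MvPolynomial
open Literature.Analysis.FluidPDE

namespace Summit.NavierStokesRegularity.NavierStokesRegularity.Theorems.PoloidalLiouville.Antidynamo

open Summit.NavierStokesRegularity.NavierStokesRegularity.Theorems.UnthreadedRigidity.VirialHorn (det3 det3_eq_inner_cross)
open Summit.NavierStokesRegularity.NavierStokesRegularity.Theorems.PoloidalLiouville (toroidalPotential exists_norm_curl_le constantOfIrrotational)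

/-! ### One line of determinant algebra -/

/-- `det3` is alternating in its last two slots. [folklore] -/
theorem det3_swap_right (a b c : EuclideanSpace ℝ (Fin 3)) : det3 a b c = -det3 a c b := by
  simp only [det3]; ring

/-- For a ZONAL profile (coaxial gradient about `a`), the toroidal field `∇P × y` is orthogonal to the axis `a`. [folklore] -/
theorem inner_cross_gradient_eq_zero_of_zonal {Q : EuclideanSpace ℝ (Fin 3) → ℝ} {a : EuclideanSpace ℝ (Fin 3)}
    (hz : ∀ y, det3 a y (gradient Q y) = 0) (y : EuclideanSpace ℝ (Fin 3)) :
    ⟪a, cross (gradient Q y) y⟫ = 0 := by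
  rw [← det3_eq_inner_cross, det3_swap_right, hz y, neg_zero]

/-! ### Vorticity of a zonal single-degree slice family vanishes (cell-flux Z) -/

/-- **ZONAL SINGLE-DEGREE SLICE FAMILIES ARE IRROTATIONAL.**  Under the rung's verbatim hypotheses with a non-zero ZONAL profile `P` (coaxial
gradient about `a ≠ 0`), `curl (v t) ≡ 0` for every `t < 0`: the link `T` comes from `toroidalPotential` (unthreaded + bounded curl), the
direction `a` from S2 and `inner_cross_gradient_eq_zero_of_zonal`, and `CellFlux.zonalUnthreadedVorticityVanishes` (KNSS Thm 5.2 in a moving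
frame, PROVED in the tree) concludes. [cite: KochNadirashviliSereginSverak2009, Thm 5.2 (arXiv:0709.3599 pp. 9–10)] -/
theorem curl_eq_zero_of_zonal
    (v : ℝ → EuclideanSpace ℝ (Fin 3) → EuclideanSpace ℝ (Fin 3)) (x₀ : EuclideanSpace ℝ (Fin 3))
    (hB : Literature.Analysis.FluidPDE.IsBoundedAncientMildSolution 1 v)
    (hm : ∀ t < 0, AEStronglyMeasurable (v t) volume)
    (hsm : ContDiffOn ℝ (⊤ : ℕ∞) (Function.uncurry v) (Set.Iio 0 ×ˢ Set.univ))
    {l : ℕ} {P : MvPolynomial (Fin 3) ℝ} (hl : 2 ≤ l) (hP : P.IsHomogeneous l) (hP0 : P ≠ 0)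
    (hharm : ∀ y : EuclideanSpace ℝ (Fin 3),
      Laplacian.laplacian (fun z : EuclideanSpace ℝ (Fin 3) => MvPolynomial.eval (fun i => z i) P) y = 0)
    {a : EuclideanSpace ℝ (Fin 3)} (ha : a ≠ 0)
    (hzon : ∀ y : EuclideanSpace ℝ (Fin 3),
      det3 a y (gradient (fun z : EuclideanSpace ℝ (Fin 3) => MvPolynomial.eval (fun i => z i) P) y) = 0)
    (hrep : ∀ t < 0, ∃ (g : ℝ → ℝ) (φ : EuclideanSpace ℝ (Fin 3) → ℝ), ∀ x,
      v t x = gradient φ x + (g ‖x - x₀‖ * MvPolynomial.eval (fun i => (x - x₀) i) P) • (x - x₀)) :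
    ∀ t < 0, ∀ x, curl (v t) x = 0 := by
  -- the link: unthreaded (junk-robust tangency, p793446-tower file 1/2) + bounded curl ⟹ a toroidal potential `T`
  have hsm' : IsSmoothSpaceTimeOn (Iio 0) v := hsm
  have hun : ∀ t < 0, ∀ x, ⟪x - x₀, curl (v t) x⟫ = 0 := by
    intro t ht x
    have h1 : ContDiff ℝ 1 (v t) := (hsm'.contDiff_slice ht).of_le (by norm_cast)
    obtain ⟨g, φ, hφ⟩ := hrep t ht
    exact inner_curl_eq_zero_of_eq_gradient_add_smul_sub
      (h := fun x => g ‖x - x₀‖ * MvPolynomial.eval (fun i => (x - x₀) i) P) x₀ h1 hφ x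
  obtain ⟨K, hK⟩ := exists_norm_curl_le hB hsm
  obtain ⟨T, -, -, hlink⟩ := toroidalPotential v x₀ K hsm hK hun
  -- the direction: `a`
  refine CellFlux.zonalUnthreadedVorticityVanishes v x₀ T hB hm hsm hlink fun t ht => ⟨a, ha, fun x => ?_⟩
  by_cases hx : x = x₀
  · -- at the centre the link gives `curl = ∇T × 0 = 0`
    rw [hlink t ht x, hx, sub_self, ← crossCLM_apply, map_zero, inner_zero_right]
  · obtain ⟨ĝ, -, hĝ⟩ := singleDegree_vorticity_structure v x₀ hB hm hsm hl hP hP0 hharm hrep t ht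
    rw [hĝ x hx, real_inner_smul_right, inner_cross_gradient_eq_zero_of_zonal hzon, mul_zero]

/-! ### ★★★ The rung for zonal profiles -/

/-- ★★★ **THE SINGLE-DEGREE RUNG FOR ZONAL PROFILES (every degree).**  `StubSingleDegreeRung`'s hypotheses with the one extra conjunct «`P` is
zonal: `∃ a ≠ 0, ∀ y, det3 a y (∇P y) = 0`» imply constant slices: `P = 0` is the gradient branch (`constant_of_forall_gradient_slices`); otherwise
`curl_eq_zero_of_zonal` and `constantOfIrrotational`.  This is the «KNSS transfer for the zonal quadratic» of the even-rung plan — in all degrees,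
and WITHOUT the (E1) assembly. [cite: KochNadirashviliSereginSverak2009, Thm 5.2 (arXiv:0709.3599 pp. 9–10)] -/
theorem singleDegreeRung_zonal
    (v : ℝ → EuclideanSpace ℝ (Fin 3) → EuclideanSpace ℝ (Fin 3)) (x₀ : EuclideanSpace ℝ (Fin 3))
    (hB : Literature.Analysis.FluidPDE.IsBoundedAncientMildSolution 1 v)
    (hm : ∀ t < 0, AEStronglyMeasurable (v t) volume)
    (hsm : ContDiffOn ℝ (⊤ : ℕ∞) (Function.uncurry v) (Set.Iio 0 ×ˢ Set.univ))
    (hform : ∃ (l : ℕ) (P : MvPolynomial (Fin 3) ℝ), 2 ≤ l ∧ P.IsHomogeneous l ∧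
      (∀ y : EuclideanSpace ℝ (Fin 3),
        Laplacian.laplacian (fun z : EuclideanSpace ℝ (Fin 3) => MvPolynomial.eval (fun i => z i) P) y = 0) ∧
      (∃ a : EuclideanSpace ℝ (Fin 3), a ≠ 0 ∧ ∀ y : EuclideanSpace ℝ (Fin 3),
        det3 a y (gradient (fun z : EuclideanSpace ℝ (Fin 3) => MvPolynomial.eval (fun i => z i) P) y) = 0) ∧
      ∀ t < 0, ∃ (g : ℝ → ℝ) (φ : EuclideanSpace ℝ (Fin 3) → ℝ), ∀ x,
        v t x = gradient φ x + (g ‖x - x₀‖ * MvPolynomial.eval (fun i => (x - x₀) i) P) • (x - x₀)) :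
    ∀ t < 0, ∃ b : EuclideanSpace ℝ (Fin 3), ∀ x, v t x = b := by
  obtain ⟨l, P, hl, hP, hharm, ⟨a, ha, hzon⟩, hrep⟩ := hform
  by_cases hP0 : P = 0
  · -- the gradient branch
    refine constant_of_forall_gradient_slices v hB hsm fun t ht => ?_
    obtain ⟨g, φ, hv⟩ := hrep t ht
    exact ⟨φ, fun x => by rw [hv x, hP0, map_zero, mul_zero, zero_smul, add_zero]⟩
  · exact constantOfIrrotational v hB hsm (curl_eq_zero_of_zonal v x₀ hB hm hsm hl hP hP0 hharm ha hzon hrep)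

/-! ### ★★ The even rung at one slice: (E1) data ⟹ constant, for every profile -/

/-- ★★ **AT ONE SLICE THE EVEN RUNG IS «(E1) data ⟹ constant slice», FOR EVERY PROFILE.**  Under the rung's verbatim hypotheses (`P ≠ 0`), fix
`t < 0` and the (E1) data of `evenRung_slice_alternative_of_rung` (p811643).  Then the slice is constant: the alternative's zonal disjunct, if it
occurs, makes `P` zonal and `singleDegreeRung_zonal` applies at every slice. [folklore] -/
theorem evenRung_slice_const_of_rung
    (v : ℝ → EuclideanSpace ℝ (Fin 3) → EuclideanSpace ℝ (Fin 3)) (x₀ : EuclideanSpace ℝ (Fin 3))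
    (hB : Literature.Analysis.FluidPDE.IsBoundedAncientMildSolution 1 v)
    (hm : ∀ t < 0, AEStronglyMeasurable (v t) volume)
    (hsm : ContDiffOn ℝ (⊤ : ℕ∞) (Function.uncurry v) (Set.Iio 0 ×ˢ Set.univ))
    {l : ℕ} {P : MvPolynomial (Fin 3) ℝ} (hl : 2 ≤ l) (hP : P.IsHomogeneous l) (hP0 : P ≠ 0)
    (hharm : ∀ y : EuclideanSpace ℝ (Fin 3),
      Laplacian.laplacian (fun z : EuclideanSpace ℝ (Fin 3) => MvPolynomial.eval (fun i => z i) P) y = 0)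
    (hrep : ∀ t < 0, ∃ (g : ℝ → ℝ) (φ : EuclideanSpace ℝ (Fin 3) → ℝ), ∀ x,
      v t x = gradient φ x + (g ‖x - x₀‖ * MvPolynomial.eval (fun i => (x - x₀) i) P) • (x - x₀))
    {t : ℝ} (ht : t < 0) {ĝ a k c e : ℝ → ℝ}
    (hcurl : ∀ x : EuclideanSpace ℝ (Fin 3), x ≠ x₀ →
      curl (v t) x = ĝ ‖x - x₀‖ •
        cross (gradient (fun z : EuclideanSpace ℝ (Fin 3) => MvPolynomial.eval (fun i => z i) P) (x - x₀)) (x - x₀))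
    (hda : ∀ r, 0 < r → DifferentiableAt ℝ a r) (hk : ∀ r, 0 < r → DifferentiableAt ℝ k r)
    (hc : ∀ r, 0 < r → DifferentiableAt ℝ c r) (he : ∀ r, 0 < r → DifferentiableAt ℝ e r)
    (hG : ∀ r, 0 < r → ĝ r = a r - deriv k r / r)
    (hdiv : ∀ r, 0 < r → r * deriv a r + ((l : ℝ) + 3) * a r + (l : ℝ) * deriv k r / r = 0)
    (hid : ∀ y : EuclideanSpace ℝ (Fin 3), y ≠ 0 →
      -((c ‖y‖ * MvPolynomial.eval (fun i => y i) P) •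
          cross (gradient (fun z : EuclideanSpace ℝ (Fin 3) => MvPolynomial.eval (fun i => z i) P) y) y) -
        (ĝ ‖y‖ * k ‖y‖) • cross (gradient (fun z : EuclideanSpace ℝ (Fin 3) =>
          ⟪gradient (fun w : EuclideanSpace ℝ (Fin 3) => MvPolynomial.eval (fun i => w i) P) z,
            gradient (fun w : EuclideanSpace ℝ (Fin 3) => MvPolynomial.eval (fun i => w i) P) z⟫) y) y -
        e ‖y‖ • cross (gradient (fun z : EuclideanSpace ℝ (Fin 3) => MvPolynomial.eval (fun i => z i) P) y) y = 0) :
    ∃ b : EuclideanSpace ℝ (Fin 3), ∀ x, v t x = b := by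
  rcases evenRung_slice_alternative_of_rung v x₀ hB hm hsm hl hP hP0 hharm hrep ht hcurl hda hk hc he hG hdiv hid
    with h | ⟨-, a₀, ha₀, hzon⟩
  · exact h
  · exact singleDegreeRung_zonal v x₀ hB hm hsm ⟨l, P, hl, hP, hharm, ⟨a₀, ha₀, hzon⟩, hrep⟩ t ht

/-- ★★ **THE RUNG FROM SLICE-WISE (E1) DATA.**  Under the rung's verbatim hypotheses (`P ≠ 0`), if at EVERY `t < 0` the (E1) data exist, every slice
is constant — the rung's conclusion.  What the (E1) hand owes is exactly the existential hypothesis `hE1`. [folklore] -/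
theorem singleDegreeRung_of_sliceData
    (v : ℝ → EuclideanSpace ℝ (Fin 3) → EuclideanSpace ℝ (Fin 3)) (x₀ : EuclideanSpace ℝ (Fin 3))
    (hB : Literature.Analysis.FluidPDE.IsBoundedAncientMildSolution 1 v)
    (hm : ∀ t < 0, AEStronglyMeasurable (v t) volume)
    (hsm : ContDiffOn ℝ (⊤ : ℕ∞) (Function.uncurry v) (Set.Iio 0 ×ˢ Set.univ))
    {l : ℕ} {P : MvPolynomial (Fin 3) ℝ} (hl : 2 ≤ l) (hP : P.IsHomogeneous l) (hP0 : P ≠ 0)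
    (hharm : ∀ y : EuclideanSpace ℝ (Fin 3),
      Laplacian.laplacian (fun z : EuclideanSpace ℝ (Fin 3) => MvPolynomial.eval (fun i => z i) P) y = 0)
    (hrep : ∀ t < 0, ∃ (g : ℝ → ℝ) (φ : EuclideanSpace ℝ (Fin 3) → ℝ), ∀ x,
      v t x = gradient φ x + (g ‖x - x₀‖ * MvPolynomial.eval (fun i => (x - x₀) i) P) • (x - x₀))
    (hE1 : ∀ t < 0, ∃ ĝ a k c e : ℝ → ℝ,
      (∀ x : EuclideanSpace ℝ (Fin 3), x ≠ x₀ →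
        curl (v t) x = ĝ ‖x - x₀‖ •
          cross (gradient (fun z : EuclideanSpace ℝ (Fin 3) => MvPolynomial.eval (fun i => z i) P) (x - x₀)) (x - x₀)) ∧
      (∀ r, 0 < r → DifferentiableAt ℝ a r) ∧ (∀ r, 0 < r → DifferentiableAt ℝ k r) ∧
      (∀ r, 0 < r → DifferentiableAt ℝ c r) ∧ (∀ r, 0 < r → DifferentiableAt ℝ e r) ∧
      (∀ r, 0 < r → ĝ r = a r - deriv k r / r) ∧
      (∀ r, 0 < r → r * deriv a r + ((l : ℝ) + 3) * a r + (l : ℝ) * deriv k r / r = 0) ∧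
      (∀ y : EuclideanSpace ℝ (Fin 3), y ≠ 0 →
        -((c ‖y‖ * MvPolynomial.eval (fun i => y i) P) •
            cross (gradient (fun z : EuclideanSpace ℝ (Fin 3) => MvPolynomial.eval (fun i => z i) P) y) y) -
          (ĝ ‖y‖ * k ‖y‖) • cross (gradient (fun z : EuclideanSpace ℝ (Fin 3) =>
            ⟪gradient (fun w : EuclideanSpace ℝ (Fin 3) => MvPolynomial.eval (fun i => w i) P) z,
              gradient (fun w : EuclideanSpace ℝ (Fin 3) => MvPolynomial.eval (fun i => w i) P) z⟫) y) y -
          e ‖y‖ • cross (gradient (fun z : EuclideanSpace ℝ (Fin 3) => MvPolynomial.eval (fun i => z i) P) y) y = 0)) :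
    ∀ t < 0, ∃ b : EuclideanSpace ℝ (Fin 3), ∀ x, v t x = b := by
  intro t ht
  obtain ⟨ĝ, a, k, c, e, hcurl, hda, hk, hc, he, hG, hdiv, hid⟩ := hE1 t ht
  exact evenRung_slice_const_of_rung v x₀ hB hm hsm hl hP hP0 hharm hrep ht hcurl hda hk hc he hG hdiv hid

end Summit.NavierStokesRegularity.NavierStokesRegularity.Theorems.PoloidalLiouville.Antidynamo

end
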